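import Literature.AnabelianGeometry.EtaleTheta.Discharge.Sec5EnvIsoChainNodesAtThetaSettingYdd
import Literature.AnabelianGeometry.EtaleTheta.Discharge.Sec5FactsMembersAtThetaSettingYdd
import Literature.AnabelianGeometry.EtaleTheta.Discharge.Sec5InvariantUnitsOfBiratAction

/-!
# [EtTh] Lemma 5.8 (Conjugation by Constants) p.331 (PDF p.105; kurims-ms p.96) — the NODE, every typed sub-row BY NAME, at the Ÿ̲̲-junction data of a theta setting

Mochizuki, *The étale theta function and its Frobenioid-theoretic manifestations*, Publ. RIMS **45** (2009), Lemma 5.8 p.331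
(PDF p.105): "write `(K^×)^{1/N} ⊆ O^×(B_N^birat)` for the subgroup of elements whose `N`-th power lies in the image of the natural
inclusion `K^× ↪ O^×(B_N^birat)`; `(O_K^×)^{1/N} := (K^×)^{1/N} ∩ O^×(B_N)`.  Then `(O_K^×)^{1/N}` is equal to the set of elements of
`O^×(B_N)` that normalize the subgroup `E_N ⊆ Aut_C(B_N)`.  In particular, we have a natural outer action of
`(O_K^×)^{1/N}/μ_N(B_N) ⥲ O_K^×` on `E_N`; this outer action extends to an outer action of `(K^×)^{1/N}/μ_N(B_N) ⥲ K^×` on `E_N`."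
Proof (ibid.): "since `Y` is geometrically connected over `K`, … the set of elements of `O^×(B_N)` that normalize … `E_N` … is equal to
the set of elements on which `Π^tp_Y` [i.e., `G_K` …] acts via multiplication by an element of `μ_N(B_N)`.  But this last set is easily
seen to coincide with `(O_K^×)^{1/N}`."  [cite: MochizukiEtTh2009, Lem 5.8 p.331 (PDF p.105)]

abc-iut cell, layer L2 = [EtTh], seat abc-iut-L2-t4 (gen 7; the §5 typer lineage of record — `FrobenioidMonoTheta.lean` p407021 carries
the typed Lemma 5.8 predicates, `SectionTorsionSubgroup.lean` p403909 its group theory), cone row `EtTh:Lem5.8` (kernel DAG alias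
`N_EtTh_Lem5_8`; director-abc P2 key 2026-08-27T02:44Z; L2-lead R973 GO).  PROOF-ONLY end-knit (no `def`, no `Prop`-valued definition, no
instance, no notation; nothing landed is edited or restated; every step a theorem cited BY NAME) that puts EVERY typed sub-row of the
node (plan/DAG.tsv `EtTh:Lem5.8/L58-A1…A5, B1, B2`) at ONE genuine carrier in ONE place, with ONE displayed residual:

CARRIER (abc-iut-w6-d053's K4 row-28 junction of record, `Discharge/Sec5EnvIsoChainNodesAtThetaSettingYdd.lean` p470463, whose
`variable` block is repeated VERBATIM): the §5 data OF A THETA SETTING with `A_⊙^bs := Ÿ̲̲` —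
`𝔉 := ThetaFrobenioid.ofThetaSettingData μ hC hS h Q R K' constEmb …` over `BiKummerSetting.mkOfThetaSettingYdd C e μ hC hS tf hZ hP NH`
(`Π^tp_X̲̲ := C.Huu`, `T := C.thetaEnvData μ hC hS`, `ι := id`; this lineage's W3-L2-01 «§5 GENUINE DATA»).
RESIDUAL DISPLAYED BY EVERY THEOREM, EXACTLY: the junction data (`tf`, `h`, `Q`, roots `Rl`/`R`, `K'`, `constEmb`, `hinvc`, `hinvp`;
Setting side `e`, `hC`, `hS`, `μ`) + `hconst` («`Aut_C(B_N)` fixes `K^× = K̈^×`»: morphisms of the tempered Frobenioid are `K`-linear,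
Def. 3.3 (iii) / 3.6 (iii)(iv); law 3 of abc-iut-L2-t11's `BiratAutAction`) + the cyclotome reading `m : μ_N(B_N) ≃ μ_N` + the ONE
dictionary binder `hD : BiratAutAction.ConstantsDictionary …` (this lineage gen 4 / abc-iut-L2-t11, class (c): the constants of `B_N` read
into `K ⊆ ℚ̄_p` `G_K`-equivariantly — Def. 3.3 (iii), Def. 3.6 (iii)(iv), "geometrically connected over `K`" p.322, Def. 5.4).  Both `hconst`
and `hD` are PRINTED PROPERTIES of «the tempered Frobenioid `C` of Example 3.9» for the curve, which enters the tree only as the abstract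
parameter `tf` (class-(b) models exist; none reads its constants into `ℚ̄_p`), so they are hypotheses ON THE PARAMETER, not gaps in
the argument.  No FACT-LIST row is a binder: F-0533/F-0534/F-0536/F-1306/F-1307/F-2494 are supplied BY NAME (K4 row 28, 6/6, p470463).

SUB-ROW ↔ THEOREM (print clause ↔ decl):
* L58-A1 «the elements of `O^×(B_N)` that normalize `E_N` = those on which `Π^tp_Y` acts via `μ_N(B_N)`» — this lineage's
  `mem_normalizer_EN_iff` (group theory, modulo `SgpCapSection`), here `mem_normalizer_EN_iff_ofThetaSettingYdd` with `SgpCapSection`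
  the THEOREM `sgpCapSection_ofThetaSettingYddData` (abc-iut-w6-d053 g5) — NO residual at all;
* L58-A3 (the arithmetic input «geometrically connected over `K`») `InvariantUnitsEqConstants` — `invariantUnitsEqConstants_ofThetaSettingYdd_of_constantsDictionary`
  ⟸ {`hconst`, `hD`} (Galois descent `ℚ̄_p^{G_K} = K` inside `ConstantsDictionary.hgc`, abc-iut-L2-t11 p438336);
* L58-A2/A4 «this last set … coincide[s] with `(O_K^×)^{1/N}`» `ConstantsActByCyclotome` (F-0535) and the MAIN ASSERTION
  `ConstantsEqNormalizer` (F-0536) — abc-iut-w6-d053's `constantsActByCyclotome_ofThetaSettingYddData` /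
  `constantsEqNormalizer_ofThetaSettingYddData` (p461358, ⟸ {`hconst`, `hgc`}) CITED with `hgc := hD.hgc`, i.e. ⟸ {`hconst`, `hD`};
* L58-A5 «a natural outer action of `(O_K^×)^{1/N}/μ_N(B_N)` on `E_N`» — `(O_K^×)^{1/N} ≤ N(E_N)` (`okxRootN_le_normalizer_EN_…`; the
  outer action itself is this lineage's CONSTRUCTION `FrobenioidMonoThetaEnv.constOut`, cited, and its image lies in `D_Y`:
  abc-iut-w6-d053's `image_constOut_subset_DY_ofThetaSettingYdd`, p470463);
* L58-B1 «this outer action extends to an outer action of `(K^×)^{1/N}/μ_N(B_N)` on `E_N`» `KxOuterActionExtends` —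
  `kxOuterActionExtends_ofThetaSettingYdd_of_constantsDictionary` ⟸ {`hconst`, `hD`} (abc-iut-w4-d095's `kxOuterActionExtends_of_biratAutAction`
  at `α :=` abc-iut-L2-t11's `biratAutAction_ofConnectedTemperoidData`);
* L58-B2 «`⥲ K^×`» `KxRootNModCyclotome` (F-0538) — this lineage's `kxRootNModCyclotome_ofThetaSettingData_of_constantsDictionary` (p440765) ⟸ {`hD`}, cited;
* headline `lem58_node_ofThetaSettingYdd_of_constantsDictionary` = the five-fold conjunction.
HONEST FRAMING: kernel-checked consequences of the cell's typed statements for data so constructed; `tf` is NOT shown inhabited for an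
actual Tate curve; nothing of [EtTh] (a refereed paper) is asserted unconditionally; a FACT row is an assumption label, not an
endorsement; nothing here bears on [IUTchIII] Cor. 3.12; no side is taken; typed ≠ proved.
-/

noncomputable section

namespace Literature.AnabelianGeometry.EtaleTheta

open CategoryTheory Opposite Literature.AlgebraicGeometry.Frobenioids Literature.AnabelianGeometry.SemiGraphs
  Literature.AnabelianGeometry.SemiGraphs.GaloisObjects Literature.AlgebraicGeometry.Frobenioids.QuasiTemperoid.BTempConnected

universe v₀

namespace ThetaFrobenioid

section Lem58Node

variable {p : ℕ} [Fact p.Prime] {D : ThetaSetting p} {E : D.EtaleThetaData} {l : ℕ} {C : E.DoubleUnderline l}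
  {e : D.toTemperedCurve.GroupLevelData} {N : ℕ+} (μ : D.CyclotomeMod l N) (hC : D.Compat) (hS : D.Sec2Hyps)
  {D₀ : Type} [Category.{v₀} D₀] {V : FrdIMonoidStub.{0}} {T₀ : RealifiedDivisorMonoids (D₀ := D₀) V}
  {VD : FrdICatStub.{1, 0, 0} (ConnectedPart (BTemp (C.temperedArithmeticGroup e).Pi))}
  {tf : TemperedFrobenioid T₀ (ConnectedPart (BTemp (C.temperedArithmeticGroup e).Pi)) VD} {hZ : tf.monoidType = MonoidType.Z}
  {hP : ∀ A : (ConnectedPart (BTemp (C.temperedArithmeticGroup e).Pi))ᵒᵖ, IsPerfect (tf.Φ.carrier A)}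
  {NH : Subgroup (Field.absoluteGaloisGroup D.K) → tf.category → ℕ+ → Prop}
  {pullFrac : ∀ {A A' : (BiKummerSetting.mkOfThetaSettingYdd C e μ hC hS tf hZ hP NH).C} (_ : A' ⟶ A),
    (BiKummerSetting.mkOfThetaSettingYdd C e μ hC hS tf hZ hP NH).biratUnits A →
      (BiKummerSetting.mkOfThetaSettingYdd C e μ hC hS tf hZ hP NH).biratUnits A'}
  {θ : (BiKummerSetting.mkOfThetaSettingYdd C e μ hC hS tf hZ hP NH).biratUnits (BiKummerSetting.mkOfThetaSettingYdd C e μ hC hS tf hZ hP NH).Aodot}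
  {Bl : (BiKummerSetting.mkOfThetaSettingYdd C e μ hC hS tf hZ hP NH).C}
  {Pl : (BiKummerSetting.mkOfThetaSettingYdd C e μ hC hS tf hZ hP NH).FractionPair θ Bl}
  {Rl : (BiKummerSetting.mkOfThetaSettingYdd C e μ hC hS tf hZ hP NH).NthRoot θ Pl C.lPNat pullFrac}
  (h : ModelFrobenioid.Hypotheses tf.divisorMonoid tf.ratFnFunctor)
  (Q : FrobenioidTheta.ThetaSubquotientStub.{0} (ConnectedPart (BTemp (C.temperedArithmeticGroup e).Pi)))
  (R : (BiKummerSetting.mkOfThetaSettingYdd C e μ hC hS tf hZ hP NH).NthRoot Rl.root Rl.pair N pullFrac)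
  (K' : Type) [Field K'] (constEmb : K'ˣ →* tf.biratUnitsModel R.BN) (constEmb_injective : Function.Injective constEmb)
  (hinvc : ∀ g : Aut R.AN.base,
    pull tf.divisorMonoid g.hom (ModelFrobenioid.div R.pair.num) = ModelFrobenioid.div R.pair.num)
  (hinvp : ∀ y : (C.thetaEnvData μ hC hS).PiX, y ∈ (C.thetaEnvData μ hC hS).PiYdd →
    pull tf.divisorMonoid ((BiKummerSetting.mkOfThetaSettingYdd C e μ hC hS tf hZ hP NH).galoisSurj
      R.AN.base R.αData.isGalois ((ContinuousMulEquiv.refl _) y)).hom (ModelFrobenioid.div R.pair.den) = ModelFrobenioid.div R.pair.den)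

/-- **L58-A1 at the Ÿ̲̲-junction data, NO residual** (Lemma 5.8 proof, group-theoretic step, p.331 (PDF p.105) ll.20–23): an element `u`
of `O^×(B_N)` normalises `E_N = s^⊓-gp_N(Im Π^tp_Y) · μ_N(B_N)` IFF `Π^tp_Y` acts on it (by conjugation through `s^⊓-gp_N`) via
multiplication by an element of `μ_N(B_N)` — this lineage's `mem_normalizer_EN_iff` with its one hypothesis `SgpCapSection` SUPPLIED by
abc-iut-w6-d053's theorem `sgpCapSection_ofThetaSettingYddData`.  [cite: MochizukiEtTh2009, Lem 5.8 proof p.331 (PDF p.105)] -/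
theorem mem_normalizer_EN_iff_ofThetaSettingYdd
    {u : Aut (ofThetaSettingData μ hC hS h Q R K' constEmb constEmb_injective hinvc hinvp).BN}
    (hu : u ∈ (ofThetaSettingData μ hC hS h Q R K' constEmb constEmb_injective hinvc hinvp).units
      (ofThetaSettingData μ hC hS h Q R K' constEmb constEmb_injective hinvc hinvp).BN) :
    u ∈ Subgroup.normalizer
        ((ofThetaSettingData μ hC hS h Q R K' constEmb constEmb_injective hinvc hinvp).EN :
          Set (Aut (ofThetaSettingData μ hC hS h Q R K' constEmb constEmb_injective hinvc hinvp).BN)) ↔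
      (ofThetaSettingData μ hC hS h Q R K' constEmb constEmb_injective hinvc hinvp).ActsByCyclotome u :=
  mem_normalizer_EN_iff _ (sgpCapSection_ofThetaSettingYddData μ hC hS h Q R K' constEmb constEmb_injective hinvc hinvp) hu

variable (hconst : ∀ (ε : Aut R.BN) (k : K'ˣ), tf.biratAutModel R.BN ε (constEmb k) = constEmb k)
  (m : (ofThetaSettingData μ hC hS h Q R K' constEmb constEmb_injective hinvc hinvp).muTorsion
      (ofThetaSettingData μ hC hS h Q R K' constEmb constEmb_injective hinvc hinvp).BN N ≃* (C.thetaEnvData μ hC hS).mu)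
  {Cst : Subgroup ((ofThetaSettingData μ hC hS h Q R K' constEmb constEmb_injective hinvc hinvp).biratUnits
      (ofThetaSettingData μ hC hS h Q R K' constEmb constEmb_injective hinvc hinvp).BN)}
  {ν' : Cst →* (PadicAlgCl p)ˣ}
  (hD : BiratAutAction.ConstantsDictionary
    (biratAutAction_ofConnectedTemperoidData (T := C.thetaEnvData μ hC hS) h Q C.odd_lPNat R (ContinuousMulEquiv.refl _) K' constEmb
      constEmb_injective hinvc hinvp hconst) C μ hC hS (ContinuousMulEquiv.refl _) m Cst ν')

include hD

/-- **L58-A3 at the Ÿ̲̲-junction data ⟸ {`hconst`, `hD`}** — the arithmetic input of the proof («since `Y` is geometrically connected over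
`K`», p.331 (PDF p.105) l.20; p.322 `K̈ = K`): the units of `B_N` fixed by conjugation through `s^⊓-gp_N(Im Π^tp_Y̲)` are EXACTLY the
constant units, `InvariantUnitsEqConstants` — `⊆` is abc-iut-L2-t11's `ConstantsDictionary.hgc` (Galois descent `ℚ̄_p^{G_K} = K`, p438336) at
`IdentifiesPiY := identifiesPiY_ofThetaSettingData` (this lineage, p440765), `⊇` is this lineage's `conj_eq_of_mem_constEmb_range` through
`invariantUnitsEqConstants_of_conjFixed` at `α := biratAutAction_ofConnectedTemperoidData … hconst`.
[cite: MochizukiEtTh2009, Lem 5.8 proof p.331 (PDF p.105); §5 p.322 (PDF p.96)] -/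
theorem invariantUnitsEqConstants_ofThetaSettingYdd_of_constantsDictionary :
    (ofThetaSettingData μ hC hS h Q R K' constEmb constEmb_injective hinvc hinvp).InvariantUnitsEqConstants :=
  invariantUnitsEqConstants_of_conjFixed _
    (biratAutAction_ofConnectedTemperoidData (T := C.thetaEnvData μ hC hS) h Q C.odd_lPNat R (ContinuousMulEquiv.refl _) K' constEmb
      constEmb_injective hinvc hinvp hconst)
    (hD.hgc (identifiesPiY_ofThetaSettingData μ hC hS h Q R K' constEmb constEmb_injective hinvc hinvp))

/-- **L58-A5 at the Ÿ̲̲-junction data ⟸ {`hconst`, `hD`}** («In particular, we have a natural outer action of `(O_K^×)^{1/N}/μ_N(B_N)` on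
`E_N`», p.331 (PDF p.105) ll.17–18): `(O_K^×)^{1/N}` NORMALISES `E_N` (so conjugation is the natural action; `μ_N(B_N) ⊆ E_N` acts by inner
automorphisms — the outer action of record is this lineage's CONSTRUCTION `FrobenioidMonoThetaEnv.constOut`, whose image lies in `D_Y` by
abc-iut-w6-d053's `image_constOut_subset_DY_ofThetaSettingYdd`, p470463).  [cite: MochizukiEtTh2009, Lem 5.8 p.331 (PDF p.105)] -/
theorem okxRootN_le_normalizer_EN_ofThetaSettingYdd_of_constantsDictionary :
    (ofThetaSettingData μ hC hS h Q R K' constEmb constEmb_injective hinvc hinvp).OKxRootN ≤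
      Subgroup.normalizer
        ((ofThetaSettingData μ hC hS h Q R K' constEmb constEmb_injective hinvc hinvp).EN :
          Set (Aut (ofThetaSettingData μ hC hS h Q R K' constEmb constEmb_injective hinvc hinvp).BN)) := by
  have hEq := constantsEqNormalizer_ofThetaSettingYddData μ hC hS h Q R K' constEmb constEmb_injective hinvc hinvp hconst
    (hD.hgc (identifiesPiY_ofThetaSettingData μ hC hS h Q R K' constEmb constEmb_injective hinvc hinvp))
  unfold ConstantsEqNormalizer at hEq
  rw [hEq]
  exact inf_le_right

/-- **L58-B1 at the Ÿ̲̲-junction data ⟸ {`hconst`, `hD`}** («this outer action extends to an outer action of `(K^×)^{1/N}/μ_N(B_N)` on `E_N`»,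
p.331 (PDF p.105) ll.18–19): `KxOuterActionExtends` — a Kummer extension of the conjugation action of the constants EXISTS, by
abc-iut-w4-d095's `kxOuterActionExtends_of_biratAutAction` at `α := biratAutAction_ofConnectedTemperoidData … hconst` (abc-iut-L2-t11),
with `SgpCapSection` the theorem `sgpCapSection_ofThetaSettingYddData` and "`⥲ K^×`" this lineage's
`kxRootNModCyclotome_ofThetaSettingData_of_constantsDictionary` (p440765).  [cite: MochizukiEtTh2009, Lem 5.8 p.331 (PDF p.105)] -/
theorem kxOuterActionExtends_ofThetaSettingYdd_of_constantsDictionary :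
    (ofThetaSettingData μ hC hS h Q R K' constEmb constEmb_injective hinvc hinvp).KxOuterActionExtends :=
  kxOuterActionExtends_of_biratAutAction _
    (sgpCapSection_ofThetaSettingYddData μ hC hS h Q R K' constEmb constEmb_injective hinvc hinvp)
    (biratAutAction_ofConnectedTemperoidData (T := C.thetaEnvData μ hC hS) h Q C.odd_lPNat R (ContinuousMulEquiv.refl _) K' constEmb
      constEmb_injective hinvc hinvp hconst)
    (kxRootNModCyclotome_ofThetaSettingData_of_constantsDictionary μ hC hS h Q R K' constEmb constEmb_injective hinvc hinvp hconst m hD)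

/-- **The cone node `EtTh:Lem5.8` at the Ÿ̲̲-junction data of a theta setting, every typed sub-row BY NAME, residual EXACTLY
{junction data, `hconst`, `m`, `hD`}:** Lemma 5.8's main assertion `ConstantsEqNormalizer` (F-0536), its proof's arithmetic step
`ConstantsActByCyclotome` (F-0535) and input `InvariantUnitsEqConstants` (L58-A3), «extends to an outer action of `(K^×)^{1/N}/μ_N(B_N)`»
`KxOuterActionExtends` (L58-B1) and «`⥲ K^×`» `KxRootNModCyclotome` (F-0538, L58-B2; this lineage's p440765) — the group-theoretic step
L58-A1 being `mem_normalizer_EN_iff_ofThetaSettingYdd` with NO residual.  `hconst` and `hD` are printed properties of the Example 3.9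
Frobenioid of the curve, here hypotheses on the abstract parameter `tf`.
[cite: MochizukiEtTh2009, Lem 5.8 p.331 (PDF p.105)] -/
theorem lem58_node_ofThetaSettingYdd_of_constantsDictionary :
    (ofThetaSettingData μ hC hS h Q R K' constEmb constEmb_injective hinvc hinvp).ConstantsEqNormalizer ∧
    (ofThetaSettingData μ hC hS h Q R K' constEmb constEmb_injective hinvc hinvp).ConstantsActByCyclotome ∧
    (ofThetaSettingData μ hC hS h Q R K' constEmb constEmb_injective hinvc hinvp).InvariantUnitsEqConstants ∧
    (ofThetaSettingData μ hC hS h Q R K' constEmb constEmb_injective hinvc hinvp).KxOuterActionExtends ∧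
    (ofThetaSettingData μ hC hS h Q R K' constEmb constEmb_injective hinvc hinvp).KxRootNModCyclotome :=
  ⟨constantsEqNormalizer_ofThetaSettingYddData μ hC hS h Q R K' constEmb constEmb_injective hinvc hinvp hconst
      (hD.hgc (identifiesPiY_ofThetaSettingData μ hC hS h Q R K' constEmb constEmb_injective hinvc hinvp)),
    constantsActByCyclotome_ofThetaSettingYddData μ hC hS h Q R K' constEmb constEmb_injective hinvc hinvp hconst
      (hD.hgc (identifiesPiY_ofThetaSettingData μ hC hS h Q R K' constEmb constEmb_injective hinvc hinvp)),
    invariantUnitsEqConstants_ofThetaSettingYdd_of_constantsDictionary μ hC hS h Q R K' constEmb constEmb_injective hinvc hinvp hconst m hD,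
    kxOuterActionExtends_ofThetaSettingYdd_of_constantsDictionary μ hC hS h Q R K' constEmb constEmb_injective hinvc hinvp hconst m hD,
    kxRootNModCyclotome_ofThetaSettingData_of_constantsDictionary μ hC hS h Q R K' constEmb constEmb_injective hinvc hinvp hconst m hD⟩

end Lem58Node

end ThetaFrobenioid

end Literature.AnabelianGeometry.EtaleTheta

end
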